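import Mathlib
import Summits.PneNP.PneNP.Theorems.SfmBlCutFromTrace
import Summits.PneNP.PneNP.Theorems.SfmBlCondExp
import Summits.PneNP.PneNP.Theorems.SfmBlSpotAccounting
import Summits.PneNP.PneNP.Theorems.SfmBlSpotBudget

/-!
# §6 assembly (mathematical half) of the line «sfm-bl»: from the greedy signing to `CutCertified`
(PROOF-SFM-BL Theorem §6 (ii)–(iv), modulo the numerical choice of constants and the FP layer)

FRONTIER F-N1c; nothing here bears on P vs NP.

DEFINITION-FREE GLUE of the landed bricks, in the leg model of `SfmBlLegModel` (legs `Fin m × Fin 3`, any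
piece structure `src, dst, own₁, own₂`; a leg partition `p : Fin m × Fin 3 → Option (Fin r)` with
`none` = the sparse remainder `R` and `some s` = spot `s`; part matrices `Mp c` given by the hypothesis
`Mp c i k = Σ_{e : i → k, p e = c} χ(y_{e.1})`):

* (A) `cutCertified_of_parts` — per-part `±1` cut bounds `X c` with `Σ_c X c < m` give `CutCertified I y`
  (`bilin_le_sum_of_parts` + `cutCertified_of_matrix_cut_lt`).
* (B) `greedy_two_part_bounds` — the JOINT POTENTIAL `F = trR/A₁ + hat/A₃`, `A₃ = (6/5)(Q₀+1)`: if
  `Σ_T trR T ≤ 2^m·A₁/10`, `Σ_T hat T ≤ 2^m·Q₀` (the averaged inputs: Prop. 7 and Lemma 10) and `y` is a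
  greedy path for `F` (hypothesis shape of `SfmBl.two_pow_smul_le_sum_of_greedy`), then `trR y < A₁` and
  `hat y < A₃` (PROOF §6 (i)–(iii): `Ψ(∅) < 0.94`, conditional expectations, nonnegativity).
* (C) `spot_cut_lt_hatE` — Prop. 9 with `B = ⋃ bad`: `σᵀM_Sφ < e(S)/30 + ê_S(T)`
  (`spot_cut_lt_of_dense` ∘ `good_of_disjoint_bad` ∘ `card_meeting_bad_le_hatE`).
* (D) `cutCertified_of_greedy` — (A)+(B)+`abs_cut_le_of_trace_pow_le`: under the budget
  `(|α|+|β|)·r/2 + Σ_s e_s/30 + A₃ ≤ m` (with `A₁ ≤ r^ℓ`, `ℓ = 2^{j+2}`) the greedy output is cut-certified.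

What is NOT here (by design): the numerical instantiation `L = 2^56`, `ℓ`, `t₀`, `γ′, γ_sp` turning
`SfmBl.sum_trace_pow_le_explicit` (Prop. 7, p3) and `SfmBl.sum_hatE_le` + pair counting (Lemma 10) into the
two averaged inputs and the budget `≤ 0.6m + 1.2`; and the FP (IsPolyTime) layer of `CandCutNormSigningFP`.
-/

namespace Summit.PneNP.PneNP.Theorems.SfmBl

open Matrix Finset BigOperators Literature.Computability.Complexity
open Summit.PneNP.PneNP.Theorems.CandCutNorm

/-! ### (C) Prop. 9 with `B = ⋃ bad`: the spot term of the final inequality -/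

/-- SPOT TERM: for a spot dense at extraction (`#E > 60γ√(|V₁||V₂|)`), legs with `|s e| ≤ 1`, a graph `G`
containing the legs and a family `bad` containing every `G`-connected pair of discrepancy
`> γ√(|W₁||W₂|)`, every `±1` cut value satisfies `σᵀMφ < #E/30 + ê`, `ê = Σ_{W ∈ bad} #{legs meeting W}`. -/
theorem spot_cut_lt_hatE {α β E : Type*} [Fintype α] [Fintype β] [Fintype E] [DecidableEq α]
    [DecidableEq β] (src : E → α) (dst : E → β) (V₁ : Finset α) (V₂ : Finset β)
    (hE : ∀ e, src e ∈ V₁ ∧ dst e ∈ V₂) (s : E → ℝ) (hs : ∀ e, |s e| ≤ 1) (M : Matrix α β ℝ)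
    (hM : ∀ i k, M i k = ∑ e ∈ Finset.univ.filter (fun e => src e = i ∧ dst e = k), s e)
    (G : SimpleGraph (α ⊕ β)) (hG : ∀ e, G.Adj (Sum.inl (src e)) (Sum.inr (dst e)))
    {γ : ℝ} (hγ : 0 ≤ γ) (bad : Finset (Finset α × Finset β))
    (hbad : ∀ (W₁ : Finset α) (W₂ : Finset β),
      (G.induce {x | Sum.elim (fun i => i ∈ W₁) (fun j => j ∈ W₂) x}).Connected →
      γ * Real.sqrt ((W₁.card : ℝ) * (W₂.card : ℝ)) < |∑ i ∈ W₁, ∑ k ∈ W₂, M i k| → (W₁, W₂) ∈ bad)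
    (hdense : 60 * γ * Real.sqrt ((V₁.card : ℝ) * (V₂.card : ℝ)) < Fintype.card E)
    (σ : α → ℝ) (φ : β → ℝ) (hσ : ∀ i, σ i = 1 ∨ σ i = -1) (hφ : ∀ k, φ k = 1 ∨ φ k = -1) :
    σ ⬝ᵥ (M *ᵥ φ) < (Fintype.card E : ℝ) / 30
      + ∑ W ∈ bad, ((Finset.univ.filter fun e => src e ∈ W.1 ∨ dst e ∈ W.2).card : ℝ) := by
  classical
  have h1 := spot_cut_lt_of_dense src dst V₁ V₂ hE s hs M hM G hG hγ
    (bad.biUnion Prod.fst) (bad.biUnion Prod.snd)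
    (fun W₁ W₂ hd₁ hd₂ hconn => good_of_disjoint_bad G M bad hbad W₁ W₂ hd₁ hd₂ hconn)
    hdense σ φ hσ hφ
  have h2 : ((Finset.univ.filter fun e =>
        src e ∈ bad.biUnion Prod.fst ∨ dst e ∈ bad.biUnion Prod.snd).card : ℝ)
      ≤ ∑ W ∈ bad, ((Finset.univ.filter fun e => src e ∈ W.1 ∨ dst e ∈ W.2).card : ℝ) := by
    exact_mod_cast card_meeting_bad_le_hatE src dst bad
  linarith

/-! ### (B) The joint potential: greedy output bounds -/

/-- GREEDY OUTPUT BOUNDS (PROOF §6 (i)–(iii)).  `trR, hat ≥ 0` with averaged bounds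
`Σ_T trR T ≤ 2^m·(A₁/10)` and `Σ_T hat T ≤ 2^m·Q₀`; `F = trR/A₁ + hat/((6/5)(Q₀+1))` (hypothesis `hF`);
`y` a greedy path for `F`.  Then `trR y < A₁` and `hat y < (6/5)(Q₀+1)`. -/
theorem greedy_two_part_bounds {m : ℕ} (trR hat F : (Fin m → Bool) → ℝ)
    (htr0 : ∀ T, 0 ≤ trR T) (hhat0 : ∀ T, 0 ≤ hat T) {A₁ Q₀ : ℝ} (hA₁ : 0 < A₁) (hQ₀ : 0 ≤ Q₀)
    (hF : ∀ T, F T = trR T / A₁ + hat T / (6 / 5 * (Q₀ + 1)))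
    (hsum₁ : ∑ T, trR T ≤ 2 ^ m * (A₁ / 10)) (hsum₂ : ∑ T, hat T ≤ 2 ^ m * Q₀)
    (y : Fin m → Bool)
    (hgreedy : ∀ (k : ℕ) (hk : k < m),
      ∑ T' ∈ Finset.univ.filter (fun T' : Fin m → Bool => ∀ i : Fin m, (i : ℕ) < k + 1 → T' i = y i), F T'
        ≤ ∑ T' ∈ Finset.univ.filter
            (fun T' : Fin m → Bool => (∀ i : Fin m, (i : ℕ) < k → T' i = y i) ∧ T' ⟨k, hk⟩ ≠ y ⟨k, hk⟩),
            F T') :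
    trR y < A₁ ∧ hat y < 6 / 5 * (Q₀ + 1) := by
  have hA₃ : 0 < 6 / 5 * (Q₀ + 1) := by positivity
  -- the average of `F` is `< 1`
  have hsumF : ∑ T, F T < 2 ^ m * (1 : ℝ) := by
    have e1 : ∑ T, F T = (∑ T, trR T) / A₁ + (∑ T, hat T) / (6 / 5 * (Q₀ + 1)) := by
      simp only [hF, Finset.sum_add_distrib, Finset.sum_div]
    rw [e1]
    have b1 : (∑ T, trR T) / A₁ ≤ 2 ^ m / 10 := by
      rw [div_le_iff₀ hA₁]; linarith
    have b2 : (∑ T, hat T) / (6 / 5 * (Q₀ + 1)) ≤ 2 ^ m * (Q₀ / (6 / 5 * (Q₀ + 1))) := by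
      rw [mul_div_assoc', div_le_div_iff_of_pos_right hA₃]; linarith
    have b3 : Q₀ / (6 / 5 * (Q₀ + 1)) < 5 / 6 := by
      rw [div_lt_iff₀ hA₃]; linarith
    have h2m : (0 : ℝ) < 2 ^ m := by positivity
    nlinarith
  have hFy : F y < 1 := lt_of_greedy_of_sum_lt F y hgreedy hsumF
  rw [hF y] at hFy
  have t1 : 0 ≤ trR y / A₁ := div_nonneg (htr0 y) hA₁.le
  have t2 : 0 ≤ hat y / (6 / 5 * (Q₀ + 1)) := div_nonneg (hhat0 y) hA₃.le
  constructor
  · have : trR y / A₁ < 1 := by linarith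
    rwa [div_lt_one hA₁] at this
  · have : hat y / (6 / 5 * (Q₀ + 1)) < 1 := by linarith
    rwa [div_lt_one hA₃] at this

/-! ### (A) Deterministic assembly over the leg partition -/

/-- DETERMINISTIC ASSEMBLY (PROOF §6 (iv), shape only): a leg partition `p` into parts `c : Option (Fin r)`
with part matrices `Mp c` (hypothesis `hMp`) and per-part `±1` cut bounds `X c`; if `Σ_c X c < m` then `y`
is cut-certified (conclusion = `CandCutNorm.CutCertified I y` written out). -/
theorem cutCertified_of_parts {n m r : ℕ} {α β : Type*} [Fintype α] [Fintype β] [DecidableEq α]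
    [DecidableEq β] (I : LocalMap 3 n m) (y : Fin m → Bool)
    (src : Fin m × Fin 3 → α) (dst : Fin m × Fin 3 → β) (own₁ : α → Fin n) (own₂ : β → Option (Fin n))
    (hsrc : ∀ j ℓ, own₁ (src (j, ℓ)) = I.vars j 0) (hz : ∀ j, own₂ (dst (j, 0)) = none)
    (ha : ∀ j, own₂ (dst (j, 1)) = some (I.vars j 1)) (hb : ∀ j, own₂ (dst (j, 2)) = some (I.vars j 2))
    (p : Fin m × Fin 3 → Option (Fin r)) (Mp : Option (Fin r) → Matrix α β ℝ)
    (hMp : ∀ c i k, Mp c i k = ∑ e ∈ Finset.univ.filter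
      (fun e : Fin m × Fin 3 => src e = i ∧ dst e = k ∧ p e = c), ((boolSign (y e.1) : ℤ) : ℝ))
    (X : Option (Fin r) → ℝ)
    (hX : ∀ c (σ : α → ℝ) (φ : β → ℝ), (∀ i, σ i = 1 ∨ σ i = -1) → (∀ k, φ k = 1 ∨ φ k = -1) →
      σ ⬝ᵥ (Mp c *ᵥ φ) ≤ X c)
    (hbudget : ∑ c, X c < m) :
    ∀ (σ φ : Fin n → ℤ), (∀ i, σ i = 1 ∨ σ i = -1) → (∀ i, φ i = 1 ∨ φ i = -1) →
      ∑ j, boolSign (y j) * σ (I.vars j 0) * (1 + φ (I.vars j 1) + φ (I.vars j 2)) < (m : ℤ) := by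
  classical
  -- the full leg matrix
  let M : Matrix α β ℝ := fun i k => ∑ e ∈ Finset.univ.filter
    (fun e : Fin m × Fin 3 => src e = i ∧ dst e = k), ((boolSign (y e.1) : ℤ) : ℝ)
  refine cutCertified_of_matrix_cut_lt I y src dst own₁ own₂ hsrc hz ha hb M (fun i k => rfl) ?_
  intro σ' φ' hσ' hφ'
  have h := bilin_le_sum_of_parts src dst (fun e => ((boolSign (y e.1) : ℤ) : ℝ)) p M (fun i k => rfl)
    Mp hMp σ' φ' X (fun c => hX c σ' φ' hσ' hφ')
  exact lt_of_le_of_lt h hbudget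

/-! ### (D) From the greedy output to the certificate -/

/-- THE GREEDY OUTPUT IS CUT-CERTIFIED (PROOF §6, mathematical half).  Universe-0 piece types `α, β` (as in
`SfmBlCutFromTrace` / `sgnMat`).  Data: instance, point `y`, piece structure, leg partition `p` with part
matrices `Mp` (`none` = remainder `R`, `some s` = spot `s`); the potential pieces `trR, hat, F` with the
averaged bounds and the greedy-path property of `y` (as in `greedy_two_part_bounds`); the link
`tr((fromBlocks 0 M_R M_Rᵀ 0)^{2^{j+2}}) ≤ trR y` and `A₁ ≤ r^{2^{j+2}}` (`0 ≤ r`); per-spot bounds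
`σᵀM_sφ < e_s/30 + hat_s(y)` (from `spot_cut_lt_hatE`) with `Σ_s hat_s(y) ≤ hat y`; and the BUDGET
`(|α|+|β|)·r/2 + Σ_s e_s/30 + (6/5)(Q₀+1) ≤ m`.  Conclusion: `CandCutNorm.CutCertified I y` (written out). -/
theorem cutCertified_of_greedy {n m r : ℕ} {α β : Type} [Fintype α] [Fintype β] [DecidableEq α]
    [DecidableEq β] (I : LocalMap 3 n m) (y : Fin m → Bool)
    (src : Fin m × Fin 3 → α) (dst : Fin m × Fin 3 → β) (own₁ : α → Fin n) (own₂ : β → Option (Fin n))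
    (hsrc : ∀ j ℓ, own₁ (src (j, ℓ)) = I.vars j 0) (hz : ∀ j, own₂ (dst (j, 0)) = none)
    (ha : ∀ j, own₂ (dst (j, 1)) = some (I.vars j 1)) (hb : ∀ j, own₂ (dst (j, 2)) = some (I.vars j 2))
    (p : Fin m × Fin 3 → Option (Fin r)) (Mp : Option (Fin r) → Matrix α β ℝ)
    (hMp : ∀ c i k, Mp c i k = ∑ e ∈ Finset.univ.filter
      (fun e : Fin m × Fin 3 => src e = i ∧ dst e = k ∧ p e = c), ((boolSign (y e.1) : ℤ) : ℝ))
    -- the potential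
    (trR hat F : (Fin m → Bool) → ℝ) (htr0 : ∀ T, 0 ≤ trR T) (hhat0 : ∀ T, 0 ≤ hat T)
    {A₁ Q₀ : ℝ} (hA₁ : 0 < A₁) (hQ₀ : 0 ≤ Q₀)
    (hF : ∀ T, F T = trR T / A₁ + hat T / (6 / 5 * (Q₀ + 1)))
    (hsum₁ : ∑ T, trR T ≤ 2 ^ m * (A₁ / 10)) (hsum₂ : ∑ T, hat T ≤ 2 ^ m * Q₀)
    (hgreedy : ∀ (k : ℕ) (hk : k < m),
      ∑ T' ∈ Finset.univ.filter (fun T' : Fin m → Bool => ∀ i : Fin m, (i : ℕ) < k + 1 → T' i = y i), F T'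
        ≤ ∑ T' ∈ Finset.univ.filter
            (fun T' : Fin m → Bool => (∀ i : Fin m, (i : ℕ) < k → T' i = y i) ∧ T' ⟨k, hk⟩ ≠ y ⟨k, hk⟩),
            F T')
    -- the remainder: trace link and the root-free threshold `A₁ ≤ r^ℓ`
    (j : ℕ) {rr : ℝ} (hrr : 0 ≤ rr) (hA₁r : A₁ ≤ rr ^ (2 ^ (j + 2)))
    (htrRy : ((Matrix.fromBlocks 0 (Mp none) (Mp none)ᵀ 0) ^ (2 ^ (j + 2))).trace ≤ trR y)
    -- the spots
    (es : Fin r → ℝ) (hatS : Fin r → ℝ) (hhatS : ∑ s, hatS s ≤ hat y)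
    (hspot : ∀ (s : Fin r) (σ : α → ℝ) (φ : β → ℝ), (∀ i, σ i = 1 ∨ σ i = -1) →
      (∀ k, φ k = 1 ∨ φ k = -1) → σ ⬝ᵥ (Mp (some s) *ᵥ φ) < es s / 30 + hatS s)
    -- the budget
    (hbudget : ((Fintype.card α : ℝ) + Fintype.card β) * rr / 2 + ∑ s, es s / 30 + 6 / 5 * (Q₀ + 1)
      ≤ m) :
    ∀ (σ φ : Fin n → ℤ), (∀ i, σ i = 1 ∨ σ i = -1) → (∀ i, φ i = 1 ∨ φ i = -1) →
      ∑ j, boolSign (y j) * σ (I.vars j 0) * (1 + φ (I.vars j 1) + φ (I.vars j 2)) < (m : ℤ) := by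
  classical
  obtain ⟨htrA, hhatA⟩ :=
    greedy_two_part_bounds trR hat F htr0 hhat0 hA₁ hQ₀ hF hsum₁ hsum₂ y hgreedy
  -- remainder bound via the trace
  have htrace : ((Matrix.fromBlocks 0 (Mp none) (Mp none)ᵀ 0) ^ (2 ^ (j + 2))).trace
      ≤ rr ^ (2 ^ (j + 2)) := by linarith
  have hR : ∀ (σ : α → ℝ) (φ : β → ℝ), (∀ i, σ i = 1 ∨ σ i = -1) → (∀ k, φ k = 1 ∨ φ k = -1) →
      σ ⬝ᵥ (Mp none *ᵥ φ) ≤ ((Fintype.card α : ℝ) + Fintype.card β) * rr / 2 := by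
    intro σ φ hσ hφ
    exact (le_abs_self _).trans (abs_cut_le_of_trace_pow_le (Mp none) σ φ hσ hφ j hrr htrace)
  -- per-part bounds
  let X : Option (Fin r) → ℝ := fun c =>
    match c with
    | none => ((Fintype.card α : ℝ) + Fintype.card β) * rr / 2
    | some s => es s / 30 + hatS s
  have hX : ∀ c (σ : α → ℝ) (φ : β → ℝ), (∀ i, σ i = 1 ∨ σ i = -1) → (∀ k, φ k = 1 ∨ φ k = -1) →
      σ ⬝ᵥ (Mp c *ᵥ φ) ≤ X c := by
    intro c σ φ hσ hφ
    cases c with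
    | none => exact hR σ φ hσ hφ
    | some s => exact (hspot s σ φ hσ hφ).le
  have hbud : ∑ c, X c < m := by
    rw [Fintype.sum_option]
    simp only [X]
    rw [Finset.sum_add_distrib]
    have : ∑ s, es s / 30 = (∑ s, es s) / 30 := by rw [Finset.sum_div]
    linarith [hhatS, hhatA]
  exact cutCertified_of_parts I y src dst own₁ own₂ hsrc hz ha hb p Mp hMp X hX hbud

end Summit.PneNP.PneNP.Theorems.SfmBl
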